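import Summits.QuantumFields.BalabanUV.T4Continuum.Support.BalabanAveragedTowerUnit

/-!
# T⁴ programme, spine node NE2 (U1a), sub-row Δ3 «NE2-WALK» (T4-DAG v27 `T4-U1a.S-NE2-D3-WALK°`) — THE DECAY CURRENCY BY
# INTERPOLATION: operator-norm η-rate ∧ level-uniform entry decay ⟹ entrywise η-rate WITH exponential off-diagonal decay

Eleventh generation of the NE2 prover lineage P1 of the cell `pub-balaban` (row NE2 owner), file 1.  After the T4-DAG writer's
scope ruling Q-NE2-c1 (journal l.12453) tier B's ROOT B (`Spine/NE2BalabanThreshold.balaban_final_rate_of_regular`) is booked as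
«NE2⁺ (single region, OPERATOR NORM, model level) ⇐ NE3»; one of the three remaining layers is the CURRENCY delta Δ3: U1a's wording
«(rate) × (printed majorant)» wants, for the unit-lattice kernels, King's shape
`|C^{(k)}(x,y) − C^{(k+n)}(x,y)| ≤ C·L^{−k}·e^{−δ₀|x−y|}` ([King1986] Lemma 4.5 (4.38) p. 674; the cell's typed consumer shape
`T4EtaRate.EtaRateIneqUnit`: `|Kd(y,y′)| ≤ B₀·e^{−δ₀·unitDist(y,y′)}·θ^k`), whereas tiers A/B deliver `‖c_k − c_∞‖_{op} ≤ C·θ^k/(1−θ)`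
(`CovariantAveragingTower.TowerLimitRate`), i.e. `|(c_k − c_∞)(x,y)| ≤ C·θ^k/(1−θ)` with NO decay factor.

THE OBSERVATION OF THIS FILE (elementary; OURS).  The decay currency costs NOTHING beyond a level-UNIFORM entry decay
`|c_k(x,y)| ≤ B·e^{−δ·dist(x,y)}` — which is exactly the KIND of bound the audited series prints (η-uniform exponential decay:
[Balaban1984PropagatorsI] (1.90) p. 33, [Balaban1985BackgroundPropagators] Thm 3.4 p. 400 / Thm 3.15 (3.187) p. 432; King (4.34)
p. 674; in the tree at `U = 1` for King's scalar operators: `King1986/UniformDecay`): from `t ≤ a` and `t ≤ b` one has `t ≤ √(ab)`,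
so
  `|(c_k − c_∞)(x,y)| ≤ min(C′θ^k, 2B·e^{−δ·dist}) ≤ √(2BC′)·(√θ)^k·e^{−(δ/2)·dist(x,y)}`:
an η-RATE FOR KERNEL ENTRIES WITH EXPONENTIAL OFF-DIAGONAL DECAY, rate exponent and decay rate HALVED (more generally
`θ^{(1−s)k}·e^{−sδ·dist}` for any `s ∈ [0,1]`, §1), still a clean geometric rate `√θ < 1` — and the spine's consumers (node U3,
row B8 «general rate») take ANY geometric rate.  No weighted (Combes–Thomas) two-level law, no position-space machinery at two
spacings is needed for the currency conversion; the decay of the LIMIT kernel is inherited from the uniform decay of the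
approximants (closedness).

CONTENTS.
 * §1 two scalar identities (`√(e^{−δu}) = e^{−(δ/2)u}`, `√(Cρ^kB′) = √(B′C)(√ρ)^k`); the interpolation inequalities
   `t ≤ √(ab)` / `t ≤ a^{1−s}b^s` are inlined where used (they exist elsewhere in the tree under unrelated import cones).
 * §2 `EntryDecay dist M B δ` (`‖M x y‖ ≤ B·e^{−δ·dist x y}`, any «distance» function), **`entryDecay_interpolate`**
   (`‖M‖ ≤ ε ∧ EntryDecay M B δ ⟹ EntryDecay M √(εB) (δ/2)`), `entryDecay_of_tendsto` (uniform decay passes to limits),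
   `entryDecay_sub`.
 * §3 the two decay-rate shapes `DecayRate dist c c_∞ B δ θ` (`‖(c_k − c_∞)(x,y)‖ ≤ Bθ^k e^{−δ·dist}`, King (4.38) with `n = ∞`) and
   `TwoLevelDecayRate dist c B δ θ` (consecutive levels, the `EtaRateIneqUnit`/`LocalRate` pattern), and the two conversions
   **`decayRate_of_opNorm_of_entryDecay`**, **`twoLevelDecayRate_of_opNorm_of_entryDecay`**.
 * §4 the tower form: **`decayRate_of_towerLimitRate`** — `TowerLimitRate A r X C ρ` ∧ level-uniform `EntryDecay` of the
   unit-lattice images `avgTow A r X k` ⟹ the limit has the same decay, `DecayRate … √(2B·C/(1−ρ)) (δ/2) √ρ` and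
   `TwoLevelDecayRate … √(2B·2C/(1−ρ)) (δ/2) √ρ`.  Tier A/B instantiate it BY NAME (the tier-B END is `Spine/NE2BalabanDecayRate`).

HONEST FRAMING (T4-DAG p. 1).  [folklore]-level real analysis over finite matrices; statements OURS, not a quotation; the
uniform decay is a HYPOTHESIS SHAPE here (displayed by whoever instantiates it; at `U ≠ 1` it is the printed KIND of bound on
Bałaban's carriers, which the tree does not construct — dictionary B0), asserted by nobody in this file; the conversion loses
half of the rate exponent and half of the decay rate (not optimal — a weighted two-level law would keep both — but sufficient
for every geometric-rate consumer of the spine).  Finite torus / linear layer when instantiated; NOT infinite volume, NOT a mass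
gap, NOT the Clay problem, NOT summit progress; NE2 (U1a) NOT proved; spine 0/9 unchanged.  HONEST DEPENDENCY: continuum YM on T⁴
⇐ BetaPertH ∧ nine spine estimates (0/9 proved); BetaPertH ⇐ (D1) ∧ (D4) ∧ CAP+tail; G-an2-4 gates asym, D1 and NE2/3/4.
ABSOLUTE RULE of the cell kept: no printed sentence is a hypothesis; no `sorry`.
-/

noncomputable section

open scoped Matrix Matrix.Norms.L2Operator
open Filter Topology

namespace Summit.QuantumFields.BalabanUV.T4Continuum.DecayRateInterpolation

open Summit.QuantumFields.BalabanUV.T4Continuum.CovariantAveragingTower (avgTow TowerLimitRate)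
open Summit.QuantumFields.BalabanUV.T4Continuum.BalabanAveragedTowerUnit (norm_entry_le_opNorm)

/-! ## §1 Two scalar identities -/

/-- `√(e^{−δu}) = e^{−(δ/2)u}`. [folklore] -/
theorem sqrt_exp_neg_mul (δ u : ℝ) : Real.sqrt (Real.exp (-(δ * u))) = Real.exp (-(δ / 2 * u)) := by
  rw [← Real.exp_half]; congr 1; ring

/-- `√(C·ρ^k·B′) = √(B′C)·(√ρ)^k` for `ρ ≥ 0` (the constant bookkeeping of §3). [folklore] -/
theorem sqrt_rate_mul_eq {C B' ρ : ℝ} (hρ : 0 ≤ ρ) (k : ℕ) :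
    Real.sqrt (C * ρ ^ k * B') = Real.sqrt (B' * C) * Real.sqrt ρ ^ k := by
  have e : ρ ^ k = (Real.sqrt ρ ^ k) ^ 2 := by rw [← pow_mul, mul_comm, pow_mul, Real.sq_sqrt hρ]
  rw [show C * ρ ^ k * B' = (B' * C) * ρ ^ k by ring, Real.sqrt_mul' _ (pow_nonneg hρ k), e,
    Real.sqrt_sq (pow_nonneg (Real.sqrt_nonneg _) _)]

/-! ## §2 Entry decay of one unit-lattice operator, and its interpolation with an operator-norm bound -/

section Entry

variable {n : Type*} [Fintype n] [DecidableEq n]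

/-- **ENTRY DECAY** of a unit-lattice operator against a «distance» `dist` (ANY real function of two sites — for the cell the
unit-torus distance `|x − y|`): `‖M x y‖ ≤ B·e^{−δ·dist x y}` for all `x, y`.  The KIND of bound the audited series prints
(η-uniform exponential decay); a hypothesis SHAPE here, asserted by nobody. [folklore] -/
def EntryDecay (dist : n → n → ℝ) (M : Matrix n n ℂ) (B δ : ℝ) : Prop :=
  ∀ x y, ‖M x y‖ ≤ B * Real.exp (-(δ * dist x y))

omit [Fintype n] [DecidableEq n] in
/-- a decaying kernel has a nonnegative constant (read at any entry). [folklore] -/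
theorem EntryDecay.nonneg [Nonempty n] {dist : n → n → ℝ} {M : Matrix n n ℂ} {B δ : ℝ} (h : EntryDecay dist M B δ) :
    0 ≤ B := by
  obtain ⟨x⟩ := ‹Nonempty n›
  have := (norm_nonneg _).trans (h x x)
  exact nonneg_of_mul_nonneg_left this (Real.exp_pos _)

omit [Fintype n] [DecidableEq n] in
/-- monotonicity in the constant. [folklore] -/
theorem EntryDecay.mono {dist : n → n → ℝ} {M : Matrix n n ℂ} {B B' δ : ℝ} (h : EntryDecay dist M B δ) (hB : B ≤ B') :
    EntryDecay dist M B' δ :=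
  fun x y => (h x y).trans (mul_le_mul_of_nonneg_right hB (Real.exp_pos _).le)

omit [Fintype n] [DecidableEq n] in
/-- differences of decaying kernels decay (constants add). [folklore] -/
theorem entryDecay_sub {dist : n → n → ℝ} {M N : Matrix n n ℂ} {B B' δ : ℝ} (hM : EntryDecay dist M B δ)
    (hN : EntryDecay dist N B' δ) : EntryDecay dist (M - N) (B + B') δ := by
  intro x y
  rw [Matrix.sub_apply, add_mul]
  exact (norm_sub_le _ _).trans (add_le_add (hM x y) (hN x y))

/-- **THE INTERPOLATION**: an operator-norm bound `‖M‖ ≤ ε` and an entry decay `B·e^{−δ·dist}` give the entry decay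
`√(εB)·e^{−(δ/2)·dist}` — SMALLNESS AND DECAY AT ONCE, each at half strength (`‖M x y‖ ≤ ‖M‖`, then `t ≤ √(ab)`). [folklore] -/
theorem entryDecay_interpolate {dist : n → n → ℝ} {M : Matrix n n ℂ} {ε B δ : ℝ} (hε : ‖M‖ ≤ ε)
    (hM : EntryDecay dist M B δ) : EntryDecay dist M (Real.sqrt (ε * B)) (δ / 2) := by
  intro x y
  have h1 : ‖M x y‖ ≤ ε := (norm_entry_le_opNorm M x y).trans hε
  have h2 := hM x y
  have h0 : 0 ≤ ‖M x y‖ := norm_nonneg _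
  -- `t ≤ a, t ≤ b, 0 ≤ t ⟹ t ≤ √(ab)`
  have key : ‖M x y‖ ≤ Real.sqrt (ε * (B * Real.exp (-(δ * dist x y)))) :=
    calc ‖M x y‖ = Real.sqrt (‖M x y‖ * ‖M x y‖) := (Real.sqrt_mul_self h0).symm
      _ ≤ Real.sqrt (ε * (B * Real.exp (-(δ * dist x y)))) := Real.sqrt_le_sqrt (mul_le_mul h1 h2 h0 (h0.trans h1))
  rwa [← mul_assoc, Real.sqrt_mul' _ (Real.exp_pos _).le, sqrt_exp_neg_mul] at key

/-- the general trade-off: `‖M‖ ≤ ε`, entry decay `(B, δ)`, `s ∈ [0,1]` ⟹ entry decay `(ε^{1−s}B^s, sδ)`. [folklore] -/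
theorem entryDecay_interpolate_rpow {dist : n → n → ℝ} {M : Matrix n n ℂ} {ε B δ s : ℝ} (hε : ‖M‖ ≤ ε)
    (hM : EntryDecay dist M B δ) (hs0 : 0 ≤ s) (hs1 : s ≤ 1) :
    EntryDecay dist M (ε ^ (1 - s) * B ^ s) (s * δ) := by
  intro x y
  have h1 : ‖M x y‖ ≤ ε := (norm_entry_le_opNorm M x y).trans hε
  have h2 := hM x y
  have h0 : 0 ≤ ‖M x y‖ := norm_nonneg _
  have hB : 0 ≤ B := nonneg_of_mul_nonneg_left (h0.trans h2) (Real.exp_pos _)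
  -- `t ≤ a, t ≤ b, 0 ≤ t, s ∈ [0,1] ⟹ t ≤ a^{1−s} b^s`
  have key : ‖M x y‖ ≤ ε ^ (1 - s) * (B * Real.exp (-(δ * dist x y))) ^ s := by
    rcases h0.eq_or_lt with hz | hpos
    · rw [← hz]; exact mul_nonneg (Real.rpow_nonneg (h0.trans h1) _) (Real.rpow_nonneg (h0.trans h2) _)
    · calc ‖M x y‖ = ‖M x y‖ ^ ((1 - s) + s) := by rw [sub_add_cancel, Real.rpow_one]
        _ = ‖M x y‖ ^ (1 - s) * ‖M x y‖ ^ s := Real.rpow_add hpos _ _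
        _ ≤ ε ^ (1 - s) * (B * Real.exp (-(δ * dist x y))) ^ s :=
            mul_le_mul (Real.rpow_le_rpow h0 h1 (by linarith)) (Real.rpow_le_rpow h0 h2 hs0) (Real.rpow_nonneg h0 _)
              (Real.rpow_nonneg (h0.trans h1) _)
  rw [Real.mul_rpow hB (Real.exp_pos _).le, ← Real.exp_mul, ← mul_assoc] at key
  convert key using 2
  congr 1; ring

omit [Fintype n] [DecidableEq n] in
/-- **UNIFORM DECAY PASSES TO THE LIMIT**: if `c_k → c_∞` and every `c_k` has entry decay `(B, δ)`, so does `c_∞` (entries are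
continuous; closed inequalities). [folklore] -/
theorem entryDecay_of_tendsto {dist : n → n → ℝ} {c : ℕ → Matrix n n ℂ} {clim : Matrix n n ℂ} {B δ : ℝ}
    (hlim : Tendsto c atTop (𝓝 clim)) (hdec : ∀ k, EntryDecay dist (c k) B δ) : EntryDecay dist clim B δ := by
  intro x y
  have hcont : Continuous fun M : Matrix n n ℂ => M x y := (continuous_apply y).comp (continuous_apply x)
  have hxy : Tendsto (fun k => c k x y) atTop (𝓝 (clim x y)) := (hcont.tendsto clim).comp hlim
  have hn : Tendsto (fun k => ‖c k x y‖) atTop (𝓝 ‖clim x y‖) := (continuous_norm.tendsto _).comp hxy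
  exact le_of_tendsto' hn fun k => hdec k x y

end Entry

/-! ## §3 The two decay-rate shapes and the conversions from operator-norm rates -/

section Shapes

variable {n : Type*} [Fintype n] [DecidableEq n]

/-- **KING's (4.38) SHAPE, limit form**: `‖(c_k − c_∞)(x,y)‖ ≤ B·θ^k·e^{−δ·dist(x,y)}` for all `k, x, y` — an η-rate for kernel
entries WITH exponential off-diagonal decay (the currency of U1a's «(rate) × (printed majorant)»; `T4EtaRate.EtaRateIneqUnit` is
the same display with `(B₀, δ₀, θ)`).  A SHAPE; instantiated below from operator-norm rates. [cite: King1986, Lemma 4.5 (4.38) p.674 (shape)] [folklore] -/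
def DecayRate (dist : n → n → ℝ) (c : ℕ → Matrix n n ℂ) (clim : Matrix n n ℂ) (B δ θ : ℝ) : Prop :=
  ∀ k x y, ‖(c k - clim) x y‖ ≤ B * θ ^ k * Real.exp (-(δ * dist x y))

/-- **KING's (4.38) SHAPE, two-level form** (consecutive levels; the pattern of `T4EtaRateMin.LocalRate` with a decay factor):
`‖(c_{k+1} − c_k)(x,y)‖ ≤ B·θ^k·e^{−δ·dist(x,y)}`. [cite: King1986, Lemma 4.5 (4.38) p.674 (shape)] [folklore] -/
def TwoLevelDecayRate (dist : n → n → ℝ) (c : ℕ → Matrix n n ℂ) (B δ θ : ℝ) : Prop :=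
  ∀ k x y, ‖(c (k + 1) - c k) x y‖ ≤ B * θ ^ k * Real.exp (-(δ * dist x y))

/-- **OPERATOR-NORM RATE ∧ UNIFORM ENTRY DECAY ⟹ KING's SHAPE (limit form)** with `(√(2BC), δ/2, √θ)`:
from `‖c_k − c_∞‖ ≤ Cθ^k`, `EntryDecay (c_k) B δ` for all `k` and `EntryDecay c_∞ B δ`. [folklore] -/
theorem decayRate_of_opNorm_of_entryDecay {dist : n → n → ℝ} {c : ℕ → Matrix n n ℂ} {clim : Matrix n n ℂ}
    {B C δ θ : ℝ} (hθ : 0 ≤ θ) (hrate : ∀ k, ‖c k - clim‖ ≤ C * θ ^ k) (hdec : ∀ k, EntryDecay dist (c k) B δ)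
    (hlim : EntryDecay dist clim B δ) : DecayRate dist c clim (Real.sqrt (2 * B * C)) (δ / 2) (Real.sqrt θ) := by
  intro k x y
  have hd : EntryDecay dist (c k - clim) (2 * B) δ := by
    have := entryDecay_sub (hdec k) hlim; rwa [← two_mul] at this
  have h := entryDecay_interpolate (hrate k) hd x y
  rwa [sqrt_rate_mul_eq hθ] at h

/-- **OPERATOR-NORM TWO-LEVEL RATE ∧ UNIFORM ENTRY DECAY ⟹ KING's SHAPE (two-level form)** with `(√(2BC), δ/2, √θ)`. [folklore] -/
theorem twoLevelDecayRate_of_opNorm_of_entryDecay {dist : n → n → ℝ} {c : ℕ → Matrix n n ℂ} {B C δ θ : ℝ} (hθ : 0 ≤ θ)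
    (hrate : ∀ k, ‖c (k + 1) - c k‖ ≤ C * θ ^ k) (hdec : ∀ k, EntryDecay dist (c k) B δ) :
    TwoLevelDecayRate dist c (Real.sqrt (2 * B * C)) (δ / 2) (Real.sqrt θ) := by
  intro k x y
  have hd : EntryDecay dist (c (k + 1) - c k) (2 * B) δ := by
    have := entryDecay_sub (hdec (k + 1)) (hdec k); rwa [← two_mul] at this
  have h := entryDecay_interpolate (hrate k) hd x y
  rwa [sqrt_rate_mul_eq hθ] at h

end Shapes

/-! ## §4 The tower form: `TowerLimitRate` ∧ uniform entry decay of the unit-lattice images ⟹ King's shape for the tower -/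

section Tower

variable {ι : ℕ → Type*} [∀ k, Fintype (ι k)] [∀ k, DecidableEq (ι k)]
variable {A : (k : ℕ) → Matrix (ι k) (ι (k + 1)) ℂ} {r : ℝ} {X : (k : ℕ) → Matrix (ι k) (ι k) ℂ} {C ρ : ℝ}

/-- consecutive unit-lattice images under a tower rate: `‖c_{k+1} − c_k‖ ≤ (2C/(1−ρ))·ρ^k`. [folklore] -/
theorem opNorm_succ_sub_le_of_rate (hρ0 : 0 ≤ ρ) (hρ1 : ρ < 1) (hC : 0 ≤ C) {clim : Matrix (ι 0) (ι 0) ℂ}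
    (hrate : ∀ k, ‖avgTow A r X k - clim‖ ≤ C * ρ ^ k / (1 - ρ)) (k : ℕ) :
    ‖avgTow A r X (k + 1) - avgTow A r X k‖ ≤ 2 * C / (1 - ρ) * ρ ^ k := by
  have h1ρ : 0 < 1 - ρ := sub_pos.mpr hρ1
  have ha := hrate (k + 1)
  have hb := hrate k
  have hstep : ρ ^ (k + 1) ≤ ρ ^ k := by
    rw [pow_succ]; exact mul_le_of_le_one_right (pow_nonneg hρ0 k) hρ1.le
  calc ‖avgTow A r X (k + 1) - avgTow A r X k‖
      = ‖(avgTow A r X (k + 1) - clim) - (avgTow A r X k - clim)‖ := by rw [sub_sub_sub_cancel_right]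
    _ ≤ ‖avgTow A r X (k + 1) - clim‖ + ‖avgTow A r X k - clim‖ := norm_sub_le _ _
    _ ≤ C * ρ ^ (k + 1) / (1 - ρ) + C * ρ ^ k / (1 - ρ) := add_le_add ha hb
    _ ≤ C * ρ ^ k / (1 - ρ) + C * ρ ^ k / (1 - ρ) := by
        gcongr
    _ = 2 * C / (1 - ρ) * ρ ^ k := by field_simp; ring

/-- **THE TOWER FORM (Δ3 «NE2-WALK» currency conversion)**: a tower limit with operator-norm rate `(C, ρ)`, `0 ≤ ρ < 1`, whose
unit-lattice images have LEVEL-UNIFORM entry decay `(B, δ)` has: a limit kernel with the SAME decay, King's (4.38) shape towards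
the limit with `(√(2B·C/(1−ρ)), δ/2, √ρ)`, and the two-level shape with `(√(2B·2C/(1−ρ)), δ/2, √ρ)` — entrywise η-rates WITH
exponential off-diagonal decay, geometric rate `√ρ < 1`.  At tiers A/B the first hypothesis is the landed ROOT A / ROOT B; the
second is the printed KIND of bound (η-uniform decay), displayed by the instantiating file. [cite: King1986, Lemma 4.5 (4.38) p.674 (shape)] [folklore] -/
theorem decayRate_of_towerLimitRate (hρ0 : 0 ≤ ρ) (hρ1 : ρ < 1) (hC : 0 ≤ C) (hT : TowerLimitRate A r X C ρ)
    {dist : ι 0 → ι 0 → ℝ} {B δ : ℝ} (hdec : ∀ k, EntryDecay dist (avgTow A r X k) B δ) :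
    ∃ clim : Matrix (ι 0) (ι 0) ℂ, Tendsto (avgTow A r X) atTop (𝓝 clim) ∧ EntryDecay dist clim B δ ∧
      DecayRate dist (avgTow A r X) clim (Real.sqrt (2 * B * (C / (1 - ρ)))) (δ / 2) (Real.sqrt ρ) ∧
      TwoLevelDecayRate dist (avgTow A r X) (Real.sqrt (2 * B * (2 * C / (1 - ρ)))) (δ / 2) (Real.sqrt ρ) := by
  obtain ⟨clim, hlim, hrate⟩ := hT
  have hlimdec : EntryDecay dist clim B δ := entryDecay_of_tendsto hlim hdec
  refine ⟨clim, hlim, hlimdec, ?_, ?_⟩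
  · refine decayRate_of_opNorm_of_entryDecay hρ0 (fun k => ?_) hdec hlimdec
    rw [mul_comm (C / (1 - ρ)), ← mul_div_assoc, mul_comm]; exact hrate k
  · exact twoLevelDecayRate_of_opNorm_of_entryDecay hρ0 (opNorm_succ_sub_le_of_rate hρ0 hρ1 hC hrate) hdec

end Tower

/-! ## §5 (v1.1, append-only) Unpacked forms: a GIVEN limit with a rate, constants read off the rate -/

section Unpacked

variable {n : Type*} [Fintype n] [DecidableEq n]

/-- the constant of a geometric rate bound towards a limit is nonnegative (read at `k = 0`). [folklore] -/
theorem const_nonneg_of_rate {E : Type*} [SeminormedAddCommGroup E] {u : ℕ → E} {v : E} {C ρ : ℝ} (hρ1 : ρ < 1)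
    (h : ∀ k, ‖u k - v‖ ≤ C * ρ ^ k / (1 - ρ)) : 0 ≤ C := by
  have h0 := (norm_nonneg _).trans (h 0)
  rw [pow_zero, mul_one] at h0
  by_contra hC
  exact absurd h0 (not_le.mpr (div_neg_of_neg_of_pos (not_le.mp hC) (sub_pos.mpr hρ1)))

/-- consecutive terms under a rate towards a given limit: `‖c_{k+1} − c_k‖ ≤ (2C/(1−ρ))·ρ^k` (no sign hypothesis on `C`). [folklore] -/
theorem norm_succ_sub_le_of_rate {E : Type*} [SeminormedAddCommGroup E] {u : ℕ → E} {v : E} {C ρ : ℝ} (hρ0 : 0 ≤ ρ)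
    (hρ1 : ρ < 1) (h : ∀ k, ‖u k - v‖ ≤ C * ρ ^ k / (1 - ρ)) (k : ℕ) : ‖u (k + 1) - u k‖ ≤ 2 * C / (1 - ρ) * ρ ^ k := by
  have hC := const_nonneg_of_rate hρ1 h
  have h1ρ : 0 < 1 - ρ := sub_pos.mpr hρ1
  have hstep : ρ ^ (k + 1) ≤ ρ ^ k := by
    rw [pow_succ]; exact mul_le_of_le_one_right (pow_nonneg hρ0 k) hρ1.le
  calc ‖u (k + 1) - u k‖ = ‖(u (k + 1) - v) - (u k - v)‖ := by rw [sub_sub_sub_cancel_right]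
    _ ≤ ‖u (k + 1) - v‖ + ‖u k - v‖ := norm_sub_le _ _
    _ ≤ C * ρ ^ (k + 1) / (1 - ρ) + C * ρ ^ k / (1 - ρ) := add_le_add (h _) (h _)
    _ ≤ C * ρ ^ k / (1 - ρ) + C * ρ ^ k / (1 - ρ) := by gcongr
    _ = 2 * C / (1 - ρ) * ρ ^ k := by field_simp; ring

/-- **THE UNPACKED TOWER FORM**: a GIVEN limit `c_∞` of a sequence of unit-lattice operators `c_k` with `‖c_k − c_∞‖ ≤ Cρ^k/(1−ρ)`,
`0 ≤ ρ < 1`, and level-uniform entry decay `(B, δ)` ⟹ `c_∞` has entry decay `(B, δ)`, King's shape towards `c_∞` with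
`(√(2B·C/(1−ρ)), δ/2, √ρ)` and the two-level shape with `(√(2B·2C/(1−ρ)), δ/2, √ρ)`.  This is `decayRate_of_towerLimitRate` for a
named limit (e.g. `NE2ColourPerturbedLayer.pertLimC`); no sign hypothesis on `C` (it is read off the rate). [cite: King1986, Lemma 4.5 (4.38) p.674 (shape)] [folklore] -/
theorem decayStations_of_rate {c : ℕ → Matrix n n ℂ} {clim : Matrix n n ℂ} {C ρ : ℝ} (hρ0 : 0 ≤ ρ) (hρ1 : ρ < 1)
    (hlim : Tendsto c atTop (𝓝 clim)) (hrate : ∀ k, ‖c k - clim‖ ≤ C * ρ ^ k / (1 - ρ))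
    {dist : n → n → ℝ} {B δ : ℝ} (hdec : ∀ k, EntryDecay dist (c k) B δ) :
    EntryDecay dist clim B δ ∧ DecayRate dist c clim (Real.sqrt (2 * B * (C / (1 - ρ)))) (δ / 2) (Real.sqrt ρ) ∧
      TwoLevelDecayRate dist c (Real.sqrt (2 * B * (2 * C / (1 - ρ)))) (δ / 2) (Real.sqrt ρ) := by
  have hlimdec : EntryDecay dist clim B δ := entryDecay_of_tendsto hlim hdec
  refine ⟨hlimdec, ?_, ?_⟩
  · refine decayRate_of_opNorm_of_entryDecay hρ0 (fun k => ?_) hdec hlimdec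
    rw [mul_comm (C / (1 - ρ)), ← mul_div_assoc, mul_comm]; exact hrate k
  · exact twoLevelDecayRate_of_opNorm_of_entryDecay hρ0 (norm_succ_sub_le_of_rate hρ0 hρ1 hrate) hdec

end Unpacked

end Summit.QuantumFields.BalabanUV.T4Continuum.DecayRateInterpolation

end
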